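import Summits.ABC.StewartYu.PadicG3TwoEndAdapter
import Summits.ABC.StewartYu.PadicG3TwoSlabFunctions
import HarnessLib

/-!
# Cell abc-stewartyu, Gen-3 frame at `p = 2` (crux `Y07Two`, stmt-ABC-19659), layer F6: the LEVEL INDUCTION
# (`PadicG3TwoMain`) — level families, admissibility against the record's schedule, the three step-`Prop`s,
# the composition, and the hook-up to the zero estimate's `FrameOutputTwo`

`Summits/ABC/StewartYu/PadicG3TwoMain.lean` — cell `abc-stewartyu` (HOME `run/shared/lean/pub/abc-stewartyu/`),
route `PadicPrimesKummerThird`, seat p5 (g3) on the F-two lead's layer plan (p3-g5, HOME/p3/memo-09 §3/§7/§8, F6).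
Definitions (two data structures, one `Prop`-structure, five `Prop`s) and theorems on the M2 datum `TwoSetup`; no
named fact, no analytic content.  Twin of the M2 composition file `PadicTwoMain.lean` (`Inv3`/`kchain3`/`ThirdStep`/
`inv3_all`/`main3`) for the Gen-3 frame, whose bottom layers are landed for a GENERIC finite family of unknowns
(`PadicG3TwoFunctions` … `PadicG3TwoSlabKStep`, p3-g5).

THE SHAPE OF THE INDUCTION (Yu 2013 §5 «first main inductive argument» (5.19)–(5.20) with Lemma 5.2 = the inner
chain and Lemmas 5.3–5.4 = the `q = 3` Kummer descent; Nesterenko 2003 §4 levels `s` with the odd-node stage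
`𝒳_{s,0}`).  A LEVEL FAMILY `Λ : G3Fam` is the data the generic layers quantify over: unknowns `i ∈ B`, `Y₀`-factors
`Rᵢ ∈ ℚ[Y₀]`, SIGNED exponent vectors `(uᵢ, u_θᵢ)`, integer coefficients `pᵢ`, and the base unknown `i₀` of the
slab (design of record D-F2).  At level `I`:
* `SiegelTwo` (level `0`, ⇐ `PadicG3TwoSlabSiegel.exists_g3_slab_siegel` in the assembly): an admissible family
  whose rational values `g3φ τ x` vanish at ALL integers `|x| ≤ N0 0`, `|τ| < T0 0`;
* `KChainTwo I` (⇐ the slab k-steps `PadicG3TwoSlabKStep` along the record's sub-schedule, discharged from a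
  numeric inequality in the sequel `PadicG3TwoMainChain`): vanishing at the nodes `|x| ≤ N0 I` COPRIME TO `3`,
  `|τ| < T0 I` ⇒ vanishing at ALL `|x| ≤ Nfin I`, `|τ| < Tfin I`;
* `ThirdStepTwo I` (⇐ p4-g3's F5 `PadicG3TwoThirdStep` + the re-indexing glue): from that, a NEW admissible family
  at level `I + 1` (one class `v (mod 3)` of exponent vectors, `u = 3u′ + v`, `Y₀` rescaled by `3`) vanishing at
  the nodes `|s| ≤ N0 (I+1)` coprime to `3`, `|τ| < T0 (I+1)` — coprime only, exactly as in print (Yu 2013 p. 353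
  «for all `|s| ≤ q([S⁽ᴵ⁺¹⁾]+1)` with `(s, q) = 1`»): at an integer `s′` only the FULL level-`I` sum is known to
  vanish, not its class-`v` part, which is why the first k-step of every level runs from the coprime nodes.
`mainTwo` composes them up to the last level `Istar`; `frameOutputTwo_of_mainTwo` feeds the last family to the
zero estimate's END through p3-g5's adapter `PadicG3TwoEndAdapter.frameOutputTwo_of_g3φ`, the nonzero fibre
coming from «some `pᵢ ≠ 0`» + «distinct `Y₀`-degrees inside a fibre» (`exists_fibre_ne_zero_of_adm`).

ADMISSIBILITY `G3Adm σ Sh I Λ` collects, against the record's level-indexed SCHEDULE `σ : G3TwoSched` (slots the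
record seat fills: box `Dbox I`/`Dθ I`, directional bound `Xb I`, `2`-adic weighted coefficient bound `Bw I` at radius
`4·2^m`, `Y₀`-weight integrality data `den₀ I x τ`/`M₀ I x τ` — POINTWISE in `(x, τ)` —, coefficient bound `P`,
family size `cardB I`, degree `D₀`, slab depth `m`), exactly the hypotheses the generic k-step and the END adapter
consume, plus an OPAQUE shape predicate `Sh I Λ` (the assembler's structural invariant — which basis, which class —
that this file never opens).

WHAT THIS IS NOT: no k-step numerics (sequel), no third step (F5), no record, no choice of the `Y₀`-basis (F7);
no crux moves.

References: K. Yu, Acta Math. 211 (2013), §5 (5.13), (5.19)–(5.20), Lemmas 5.2–5.4; Yu. V. Nesterenko, LNM 1819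
(2003), §4 (4.3)–(4.5), §5.1; K. Yu, Acta Arith. 53 (1989), §3.
-/

noncomputable section

open Finset Polynomial
open Literature.NumberTheory.Transcendental
open Literature.NumberTheory.Transcendental.CW77.Setup (Tau tauNorm)

namespace Summit.ABC.StewartYu

namespace TwoSetup

variable (S : TwoSetup)

/-! ### Level families and their vanishing statements -/

/-- **A LEVEL FAMILY of the Gen-3 `2`-adic frame**: unknowns `i ∈ B`, `Y₀`-factors `Rᵢ`, signed exponent vectors
`(uᵢ, u_θᵢ)`, integer coefficients `pᵢ`, and the base unknown `i₀` of the slab class (the data the generic layers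
`PadicG3TwoFunctions` … `PadicG3TwoSlabKStep` quantify over; Yu's level data `(Λ⁽ᴵ⁾, x⁽ᴵ⁾, ϱ⁽ᴵ⁾)`).
[cite: Yu2013, §5 (5.1)–(5.4); shape only] -/
structure G3Fam (ι : Type*) where
  /-- the unknowns -/
  B : Finset ι
  /-- the `Y₀`-factor of the unknown `i` -/
  R : ι → ℚ[X]
  /-- the exponent vector of the unknown `i` in the `d` free generators -/
  u : ι → Fin S.d → ℤ
  /-- the exponent of the unknown `i` in the eliminated generator `θ` -/
  uθ : ι → ℤ
  /-- the integer coefficients -/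
  p : ι → ℤ
  /-- the base unknown of the slab class -/
  i₀ : ι

/-- The node predicate «every integer». [folklore] -/
def nodesAll : ℤ → Prop := fun _ => True

/-- The node predicate «integers coprime to `3`» (the points `s/3`, `3 ∤ s`, of the Kummer descent).
[cite: Yu2013, Lemma 5.4; shape only] -/
def nodesCop : ℤ → Prop := fun x => ¬ (3 : ℤ) ∣ x

namespace G3Fam

variable {S} {ι : Type*} (Λ : S.G3Fam ι)

/-- **Vanishing of the rational values of a level family**: `g3φ τ x = 0` for all integers `|x| ≤ N` with
`good x` and all multi-indices `|τ| < T`. [cite: Yu2013, (5.20), (5.23); shape only] -/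
def vanish (good : ℤ → Prop) (N T : ℕ) : Prop :=
  ∀ x : ℤ, |x| ≤ (N : ℤ) → good x → ∀ τ : Tau S.d, tauNorm τ < T →
    S.g3φ Λ.R Λ.u Λ.uθ Λ.B Λ.p τ x = 0

/-- Vanishing is monotone in the range and the order. [folklore] -/
theorem vanish_mono {good : ℤ → Prop} {N N' T T' : ℕ} (hN : N' ≤ N) (hT : T' ≤ T)
    (h : Λ.vanish good N T) : Λ.vanish good N' T' := by
  intro x hx hg τ hτ
  exact h x (hx.trans (by exact_mod_cast hN)) hg τ (lt_of_lt_of_le hτ hT)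

/-- Vanishing at more nodes implies vanishing at fewer. [folklore] -/
theorem vanish_imp {good good' : ℤ → Prop} (hg : ∀ x, good' x → good x) {N T : ℕ}
    (h : Λ.vanish good N T) : Λ.vanish good' N T :=
  fun x hx hg' τ hτ => h x hx (hg x hg') τ hτ

/-- Vanishing at all nodes implies vanishing at the nodes coprime to `3`. [folklore] -/
theorem vanish_cop_of_all {N T : ℕ} (h : Λ.vanish nodesAll N T) : Λ.vanish nodesCop N T :=
  Λ.vanish_imp (fun _ _ => trivial) h

/-- Unfolding `vanish nodesAll`. [folklore] -/
theorem vanish_all_iff {N T : ℕ} :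
    Λ.vanish nodesAll N T ↔ ∀ x : ℤ, |x| ≤ (N : ℤ) → ∀ τ : Tau S.d, tauNorm τ < T →
      S.g3φ Λ.R Λ.u Λ.uθ Λ.B Λ.p τ x = 0 :=
  ⟨fun h x hx τ hτ => h x hx trivial τ hτ, fun h x hx _ τ hτ => h x hx τ hτ⟩

end G3Fam

/-! ### The record's schedule and admissibility -/

/-- **The record's level-indexed SCHEDULE** for the Gen-3 `2`-adic frame: the slots the parameter ledger
(Yu 2013 (3.1)–(3.9), (5.13); Nesterenko (4.3)–(4.5)) fills and the frame's layers consume — number of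
descent levels `Istar`, slab depth `m`, `Y₀`-degree `D₀`, coefficient bound `P`, and per level `I`: family size
`cardB I`, exponent box `Dbox I`/`Dθ I`, directional bound `Xb I`, weighted `2`-adic coefficient bound `Bw I`
(radius `4·2^m`), pointwise `Y₀`-weight data `den₀ I x τ`/`M₀ I x τ`, and the ranges/orders `N0 I`/`T0 I` at the
start of the level (Siegel resp. third-step output) and `Nfin I`/`Tfin I` after the inner chain, with the
inner chain's sub-schedule `kst I`, `tdec I`, `Nsub I k` (consumed only by the sequel `PadicG3TwoMainChain`, which
states the consistency `Nsub I 0 = N0 I`, `Nsub I (kst I) = Nfin I`, `Tfin I ≤ T0 I − kst I·tdec I`).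
[cite: Yu2013, §3.1 (3.1)–(3.9) and (5.13); shape only] -/
structure G3TwoSched where
  /-- number of descent levels (third steps) -/
  Istar : ℕ
  /-- slab depth -/
  m : ℕ
  /-- bound for the `Y₀`-degrees -/
  D₀ : ℕ
  /-- bound for the coefficients -/
  P : ℤ
  /-- bound for the number of unknowns at level `I` -/
  cardB : ℕ → ℕ
  /-- exponent box in the free generators at level `I` -/
  Dbox : ℕ → Fin S.d → ℕ
  /-- exponent box in `θ` at level `I` -/
  Dθ : ℕ → ℕ
  /-- bound for the directional scalars at level `I` -/
  Xb : ℕ → ℤ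
  /-- weighted `2`-adic coefficient bound of the `Y₀`-weights at level `I` (radius `4·2^m`) -/
  Bw : ℕ → ℝ
  /-- denominators of the `Y₀`-weights at level `I`, point `x`, multi-index `τ` -/
  den₀ : ℕ → ℤ → Tau S.d → ℕ
  /-- sizes of the cleared `Y₀`-weights at level `I`, point `x`, multi-index `τ` -/
  M₀ : ℕ → ℤ → Tau S.d → ℤ
  /-- range at the start of level `I` -/
  N0 : ℕ → ℕ
  /-- order at the start of level `I` -/
  T0 : ℕ → ℕ
  /-- range after the inner chain of level `I` -/
  Nfin : ℕ → ℕ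
  /-- order after the inner chain of level `I` -/
  Tfin : ℕ → ℕ
  /-- number of k-steps in the inner chain of level `I` (sub-schedule, consumed by the sequel) -/
  kst : ℕ → ℕ
  /-- order decrement per k-step at level `I` (sub-schedule) -/
  tdec : ℕ → ℕ
  /-- range after `k` k-steps of level `I` (sub-schedule; `Nsub I 0 = N0 I`, `Nsub I (kst I) = Nfin I`) -/
  Nsub : ℕ → ℕ → ℕ

/-- **ADMISSIBILITY of a level family at level `I`** against the schedule `σ` and the assembler's opaque shape
predicate `Sh`: exactly the hypotheses of the generic k-step (`PadicG3TwoSlabKStep.g3_slab_kstep`: box, directional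
bound, coefficient bound, slab, weighted coefficient bound, pointwise `Y₀`-weight integrality) and of the END
adapter (`PadicG3TwoEndAdapter.frameOutputTwo_of_g3φ`: degrees, box, a nonzero fibre — here from «some `pᵢ ≠ 0`»
and «distinct `Y₀`-degrees inside every exponent fibre»). [cite: Yu2013, §5 (5.1) and (4.26); shape only] -/
structure G3Adm {ι : Type*} (σ : S.G3TwoSched) (Sh : ℕ → S.G3Fam ι → Prop) (I : ℕ) (Λ : S.G3Fam ι) :
    Prop where
  /-- family size -/
  card_le : Λ.B.card ≤ σ.cardB I
  /-- some coefficient is nonzero -/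
  exists_ne : ∃ i ∈ Λ.B, Λ.p i ≠ 0
  /-- distinct unknowns with the same exponent vector have `Y₀`-factors of distinct degrees -/
  deg_ne : ∀ i ∈ Λ.B, ∀ i' ∈ Λ.B, S.allκ Λ.u Λ.uθ i = S.allκ Λ.u Λ.uθ i' → i ≠ i' →
    (Λ.R i).natDegree ≠ (Λ.R i').natDegree
  /-- the `Y₀`-factors are nonzero -/
  R_ne : ∀ i ∈ Λ.B, Λ.R i ≠ 0
  /-- the `Y₀`-degrees -/
  deg_le : ∀ i ∈ Λ.B, (Λ.R i).natDegree ≤ σ.D₀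
  /-- the coefficients -/
  p_le : ∀ i ∈ Λ.B, |Λ.p i| ≤ σ.P
  /-- the exponent box in the free generators -/
  u_le : ∀ i ∈ Λ.B, ∀ j, |Λ.u i j| ≤ (σ.Dbox I j : ℤ)
  /-- the exponent box in `θ` -/
  uθ_le : ∀ i ∈ Λ.B, |Λ.uθ i| ≤ (σ.Dθ I : ℤ)
  /-- the directional scalars -/
  dir_le : ∀ i ∈ Λ.B, ∀ j, |S.dirScalar (Λ.u i) (Λ.uθ i) j| ≤ σ.Xb I
  /-- the slab (D-F2): exponents congruent to the base unknown's modulo `2^{m+3}` -/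
  slab : ∀ i ∈ Λ.B, ‖S.δexpo Λ.u Λ.uθ Λ.i₀ i‖ ≤ ((2 : ℝ) ^ (σ.m + 3))⁻¹
  /-- weighted `2`-adic coefficient bound of the `Y₀`-weights at radius `4·2^m` -/
  wt : ∀ i ∈ Λ.B, ∀ t₀ k, ‖(hw Λ.R i t₀).coeff k‖ * (4 * (2 : ℝ) ^ σ.m) ^ k ≤ σ.Bw I
  /-- pointwise integrality and size of the `Y₀`-weights at the integer points -/
  hasse : ∀ i ∈ Λ.B, ∀ (x : ℤ) (τ : Tau S.d), ∃ z₀ : ℤ,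
    (σ.den₀ I x τ : ℚ) * (hasseDeriv τ.1 (Λ.R i)).eval (x : ℚ) = z₀ ∧ |z₀| ≤ σ.M₀ I x τ
  /-- the assembler's structural invariant -/
  shape : Sh I Λ

/-! ### The three step-`Prop`s and the invariant -/

variable {S} {ι : Type*} (σ : S.G3TwoSched) (Sh : ℕ → S.G3Fam ι → Prop)

/-- **Level `0` (Siegel's lemma on the slab class)**: an admissible family whose values vanish at all integers
`|x| ≤ N0 0`, `|τ| < T0 0`. [cite: Yu2013, Lemma 4.2 and (5.22); shape only] -/
def SiegelTwo : Prop :=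
  ∃ Λ : S.G3Fam ι, S.G3Adm σ Sh 0 Λ ∧ Λ.vanish nodesAll (σ.N0 0) (σ.T0 0)

/-- **The inner chain at level `I`** (Yu 2013 Lemma 5.2; the `2`-adic k-steps of `PadicG3TwoSlabKStep` along the
record's sub-schedule): for every admissible family, vanishing at the nodes `|x| ≤ N0 I` coprime to `3`,
`|τ| < T0 I`, implies vanishing at all `|x| ≤ Nfin I`, `|τ| < Tfin I`. [cite: Yu2013, Lemma 5.2; shape only] -/
def KChainTwo (I : ℕ) : Prop :=
  ∀ Λ : S.G3Fam ι, S.G3Adm σ Sh I Λ → Λ.vanish nodesCop (σ.N0 I) (σ.T0 I) →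
    Λ.vanish nodesAll (σ.Nfin I) (σ.Tfin I)

/-- **The third step at level `I`** (Yu 2013 Lemmas 5.3–5.4, the `q = 3` Kummer descent with re-indexing
`u = 3u′ + v`): from an admissible family vanishing at all `|x| ≤ Nfin I`, `|τ| < Tfin I`, an admissible family at
level `I + 1` vanishing at the nodes `|s| ≤ N0 (I+1)` COPRIME TO `3`, `|τ| < T0 (I+1)`.
[cite: Yu2013, Lemmas 5.3–5.4; shape only] -/
def ThirdStepTwo (I : ℕ) : Prop :=
  ∀ Λ : S.G3Fam ι, S.G3Adm σ Sh I Λ → Λ.vanish nodesAll (σ.Nfin I) (σ.Tfin I) →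
    ∃ Λ' : S.G3Fam ι, S.G3Adm σ Sh (I + 1) Λ' ∧ Λ'.vanish nodesCop (σ.N0 (I + 1)) (σ.T0 (I + 1))

/-- **The invariant at level `I`** (Yu's (5.19)–(5.20)): an admissible family vanishing at the nodes
`|x| ≤ N0 I` coprime to `3`, `|τ| < T0 I`. [cite: Yu2013, (5.19)–(5.20); shape only] -/
def InvTwo (I : ℕ) : Prop :=
  ∃ Λ : S.G3Fam ι, S.G3Adm σ Sh I Λ ∧ Λ.vanish nodesCop (σ.N0 I) (σ.T0 I)

/-! ### Composition -/

/-- Level `0`: Siegel's lemma starts the invariant. [cite: Yu2013, (5.22)] -/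
theorem invTwo_zero (hS : SiegelTwo σ Sh) : InvTwo σ Sh 0 := by
  obtain ⟨Λ, hadm, hvan⟩ := hS
  exact ⟨Λ, hadm, Λ.vanish_cop_of_all hvan⟩

/-- **The invariant passes from `I` to `I + 1`**: inner chain, then the third step. [cite: Yu2013, §5] -/
theorem invTwo_succ {I : ℕ} (hk : KChainTwo σ Sh I) (hth : ThirdStepTwo σ Sh I) (h : InvTwo σ Sh I) :
    InvTwo σ Sh (I + 1) := by
  obtain ⟨Λ, hadm, hvan⟩ := h
  exact hth Λ hadm (hk Λ hadm hvan)

/-- **The invariant at every level `I ≤ Istar`.** [cite: Yu2013, §5 (first main inductive argument)] -/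
theorem invTwo_all (hS : SiegelTwo σ Sh) (hk : ∀ I, I < σ.Istar → KChainTwo σ Sh I)
    (hth : ∀ I, I < σ.Istar → ThirdStepTwo σ Sh I) :
    ∀ I, I ≤ σ.Istar → InvTwo σ Sh I := by
  intro I
  induction I with
  | zero => intro _; exact invTwo_zero σ Sh hS
  | succ I ih =>
    intro hI
    have hI' : I < σ.Istar := by omega
    exact invTwo_succ σ Sh (hk I hI') (hth I hI') (ih hI'.le)

/-- **THE LEVEL INDUCTION OF THE Gen-3 `2`-ADIC FRAME**: if Siegel's lemma starts the descent, every inner chain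
extrapolates and every third step passes the invariant up, then at the last level `Istar` there is an admissible
family whose rational values vanish at ALL integers `|x| ≤ Nfin Istar` for all `|τ| < Tfin Istar` — the frame's
native identities for the zero estimate's END. [cite: Yu2013, §5 (5.19)–(5.20) with I = I₀; shape only] -/
theorem mainTwo (hS : SiegelTwo σ Sh) (hk : ∀ I, I ≤ σ.Istar → KChainTwo σ Sh I)
    (hth : ∀ I, I < σ.Istar → ThirdStepTwo σ Sh I) :
    ∃ Λ : S.G3Fam ι, S.G3Adm σ Sh σ.Istar Λ ∧ Λ.vanish nodesAll (σ.Nfin σ.Istar) (σ.Tfin σ.Istar) := by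
  obtain ⟨Λ, hadm, hvan⟩ :=
    invTwo_all σ Sh hS (fun I hI => hk I hI.le) hth σ.Istar le_rfl
  exact ⟨Λ, hadm, hk σ.Istar le_rfl Λ hadm hvan⟩

/-! ### The nonzero fibre and the hook-up to `FrameOutputTwo` -/

/-- **A nonzero exponent fibre from admissibility**: if some `pᵢ ≠ 0` and distinct unknowns with the same
exponent vector carry `Y₀`-factors of distinct degrees, then the fibre of that exponent vector has
`∑ pᵢ·Rᵢ ≠ 0` (its top-degree term survives) — the `hne` input of the END adapter. [folklore] -/
theorem exists_fibre_ne_zero_of_adm {I : ℕ} {Λ : S.G3Fam ι} (h : S.G3Adm σ Sh I Λ) :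
    ∃ κ₀ : Fin (S.d + 1) → ℤ,
      ∑ i ∈ Λ.B.filter (fun i => S.allκ Λ.u Λ.uθ i = κ₀), (Λ.p i : ℚ) • Λ.R i ≠ 0 := by
  classical
  obtain ⟨i₁, hi₁, hp₁⟩ := h.exists_ne
  refine ⟨S.allκ Λ.u Λ.uθ i₁, ?_⟩
  -- the fibre of `i₁` and its unknowns with a nonzero coefficient
  set F : Finset ι := Λ.B.filter (fun i => S.allκ Λ.u Λ.uθ i = S.allκ Λ.u Λ.uθ i₁) with hF
  set F' : Finset ι := F.filter (fun i => Λ.p i ≠ 0) with hF'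
  have hi₁F : i₁ ∈ F := Finset.mem_filter.mpr ⟨hi₁, rfl⟩
  have hi₁F' : i₁ ∈ F' := Finset.mem_filter.mpr ⟨hi₁F, hp₁⟩
  have hF'ne : F'.Nonempty := ⟨i₁, hi₁F'⟩
  -- the unknown of maximal `Y₀`-degree among them
  obtain ⟨i₂, hi₂, hmax⟩ := Finset.exists_max_image F' (fun i => (Λ.R i).natDegree) hF'ne
  have hi₂F : i₂ ∈ F := (Finset.mem_filter.mp hi₂).1
  have hi₂B : i₂ ∈ Λ.B := (Finset.mem_filter.mp hi₂F).1
  have hp₂ : Λ.p i₂ ≠ 0 := (Finset.mem_filter.mp hi₂).2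
  have hκ₂ : S.allκ Λ.u Λ.uθ i₂ = S.allκ Λ.u Λ.uθ i₁ := (Finset.mem_filter.mp hi₂F).2
  -- the sum over the fibre equals the sum over `F'`
  have hsum : ∑ i ∈ F, (Λ.p i : ℚ) • Λ.R i = ∑ i ∈ F', (Λ.p i : ℚ) • Λ.R i := by
    rw [hF']
    refine (Finset.sum_filter_of_ne fun i _ hne => ?_).symm
    intro hpi
    apply hne
    rw [hpi, Int.cast_zero, zero_smul]
  -- its coefficient in degree `natDegree (R i₂)` is `p i₂ · leadingCoeff (R i₂) ≠ 0`
  set n₂ : ℕ := (Λ.R i₂).natDegree with hn₂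
  have hcoeff : (∑ i ∈ F', (Λ.p i : ℚ) • Λ.R i).coeff n₂ = (Λ.p i₂ : ℚ) * (Λ.R i₂).leadingCoeff := by
    rw [Polynomial.finsetSum_coeff, ← Finset.add_sum_erase F' _ hi₂]
    have hrest : ∑ i ∈ F'.erase i₂, ((Λ.p i : ℚ) • Λ.R i).coeff n₂ = 0 := by
      refine Finset.sum_eq_zero fun i hi => ?_
      have hiF' : i ∈ F' := Finset.mem_of_mem_erase hi
      have hine : i ≠ i₂ := Finset.ne_of_mem_erase hi
      have hiF : i ∈ F := (Finset.mem_filter.mp hiF').1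
      have hiB : i ∈ Λ.B := (Finset.mem_filter.mp hiF).1
      have hκ : S.allκ Λ.u Λ.uθ i = S.allκ Λ.u Λ.uθ i₂ := by
        rw [(Finset.mem_filter.mp hiF).2, hκ₂]
      have hne' : (Λ.R i).natDegree ≠ n₂ := h.deg_ne i hiB i₂ hi₂B hκ hine
      have hlt : (Λ.R i).natDegree < n₂ := lt_of_le_of_ne (hmax i hiF') hne'
      rw [Polynomial.coeff_smul, Polynomial.coeff_eq_zero_of_natDegree_lt hlt, smul_zero]
    rw [hrest, add_zero, Polynomial.coeff_smul, smul_eq_mul, hn₂, Polynomial.coeff_natDegree]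
  have hlc : (Λ.R i₂).leadingCoeff ≠ 0 := Polynomial.leadingCoeff_ne_zero.mpr (h.R_ne i₂ hi₂B)
  have hne : (∑ i ∈ F', (Λ.p i : ℚ) • Λ.R i).coeff n₂ ≠ 0 := by
    rw [hcoeff]
    exact mul_ne_zero (by exact_mod_cast hp₂) hlc
  intro hzero
  apply hne
  rw [← hsum, hzero, Polynomial.coeff_zero]

/-- **HOOK-UP TO THE ZERO ESTIMATE**: under the hypotheses of `mainTwo`, if the last range covers `(d+2)·X` and
the last order exceeds `(d+2)·S₀`, the frame output `FrameOutputTwo (d+1) (α, θ) (b, b_θ) θ D₀ S₀ X (Dbox, Dθ)` of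
`GenThreeFrameSpecTwo` holds (via p3-g5's adapter `frameOutputTwo_of_g3φ`).
[cite: Nesterenko2003, §5.1 (5.1)–(5.4)] [cite: Yu2013, §6; shape only] -/
theorem frameOutputTwo_of_mainTwo (hS : SiegelTwo σ Sh) (hk : ∀ I, I ≤ σ.Istar → KChainTwo σ Sh I)
    (hth : ∀ I, I < σ.Istar → ThirdStepTwo σ Sh I) {X S₀ : ℕ}
    (hX : (S.d + 1 + 1) * X ≤ σ.Nfin σ.Istar) (hT : (S.d + 1 + 1) * S₀ < σ.Tfin σ.Istar) :
    GenThreeFrameSpecTwo.FrameOutputTwo (S.d + 1) S.toQ.all S.ball (Fin.last S.d) σ.D₀ S₀ X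
      (Fin.snoc (σ.Dbox σ.Istar) (σ.Dθ σ.Istar)) := by
  obtain ⟨Λ, hadm, hvan⟩ := mainTwo σ Sh hS hk hth
  refine S.frameOutputTwo_of_g3φ Λ.R Λ.u Λ.uθ Λ.B Λ.p hadm.deg_le hadm.u_le hadm.uθ_le
    (exists_fibre_ne_zero_of_adm σ Sh hadm) ?_
  intro x hx τ hτ
  refine hvan x (hx.trans ?_) trivial τ (lt_of_le_of_lt hτ hT)
  exact_mod_cast hX

/-- The same hook-up from the CONCLUSION of `mainTwo` (an admissible last-level family with its vanishing), for an
assembler that establishes the last level by other means. [cite: Nesterenko2003, §5.1 (5.1)–(5.4)] -/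
theorem frameOutputTwo_of_adm_vanish {I : ℕ} {Λ : S.G3Fam ι} (hadm : S.G3Adm σ Sh I Λ) {N T : ℕ}
    (hvan : Λ.vanish nodesAll N T) {X S₀ : ℕ} (hX : (S.d + 1 + 1) * X ≤ N) (hT : (S.d + 1 + 1) * S₀ < T) :
    GenThreeFrameSpecTwo.FrameOutputTwo (S.d + 1) S.toQ.all S.ball (Fin.last S.d) σ.D₀ S₀ X
      (Fin.snoc (σ.Dbox I) (σ.Dθ I)) := by
  refine S.frameOutputTwo_of_g3φ Λ.R Λ.u Λ.uθ Λ.B Λ.p hadm.deg_le hadm.u_le hadm.uθ_le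
    (exists_fibre_ne_zero_of_adm σ Sh hadm) ?_
  intro x hx τ hτ
  refine hvan x (hx.trans ?_) trivial τ (lt_of_le_of_lt hτ hT)
  exact_mod_cast hX

end TwoSetup

end Summit.ABC.StewartYu

end
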